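import Summits.PneNP.PneNP.Theses.EquivariantThetaLift
import Literature.Combinatorics.Optimization.MatchingInvariantSubspaces
import HarnessLib

/-!
# Route `EquivariantThetaLift`, crux `InvariantSubspaceLowDegree`: closed by the tree theorem

The route's crux `Summit.PneNP.PneNP.Theses.EquivariantThetaLift.InvariantSubspaceLowDegree` (for even
`n ≥ 4k + 2`, every `S_n`-invariant subspace of functions on the perfect matchings of `K_n` of
dimension `< 2^k` lies in `polLE n k`, the span of the `k`-edge monomial functions) is PROVED in the
tree as `Literature.Combinatorics.Optimization.invariantSubspaceLowDegree`
(`Literature/Combinatorics/Optimization/MatchingInvariantSubspaces.lean`: pull back to `ℂ[S_n]`,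
Fourier vanishing of the Specht components with `f^μ > dim` (left invariance) or with a long first
column (right invariance under the pair stabiliser), Ellis–Friedgut–Pilpel Thm. 7 (`2k`-coset span),
push-forward to pin counts, and `spechtDimDichotomy`). Nothing is re-proved here (D-0059).
-/

set_option linter.dupNamespace false -- `Summit.PneNP.PneNP.…`: summit = sub-problem (D-0017)

namespace Summit.PneNP.PneNP.Theorems

/-- **Crux `InvariantSubspaceLowDegree` of route `EquivariantThetaLift`** — by the tree theorem
`Literature.Combinatorics.Optimization.invariantSubspaceLowDegree`.
[cite: EllisFriedgutPilpel2011, Thm. 7; FawziSaundersonParrilo2013, Thm. 4] -/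
theorem InvariantSubspaceLowDegree_proof :
    Summit.PneNP.PneNP.Theses.EquivariantThetaLift.InvariantSubspaceLowDegree :=
  Literature.Combinatorics.Optimization.invariantSubspaceLowDegree

end Summit.PneNP.PneNP.Theorems
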